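import Literature.Analysis.FluidPDE.KNSSTypeIRateMildBridge
import Literature.Analysis.FluidPDE.KNSSMildDecayProofs
import Literature.Analysis.FluidPDE.KNSSTypeIRateMildProofs
import Literature.Analysis.FluidPDE.KNSSTypeIRateMildCompactnessProofs
import Literature.Analysis.FluidPDE.KNSSTypeIRateMildVertexProofs
import HarnessLib

/-!
# KNSS 2009, Theorem 6.2: the mildness clause `KNSS2009_typeI_rate_mild` discharged, and the
# main step of Theorem 6.2 from the Liouville step alone

Analysis/FluidPDE proof file (everything proved; no definitions, no named facts) for the named
fact `Literature.Analysis.FluidPDE.KNSS2009_typeI_rate_mild` (`KNSSTypeIRateMild.lean`;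
Koch–Nadirashvili–Seregin–Šverák, *Liouville theorems for the Navier–Stokes equations and
applications*, Acta Math. 203 (2009) 83–105 = arXiv:0709.3599, Theorem 6.2, p. 12: "Moreover,
`u` is a mild solution of the Navier–Stokes equations (for a suitable initial datum)"; proof,
first sentence, p. 12: "We have seen in the proof of Theorem 6.1 that (6.4) implies that `u` is
a mild solution for a suitable initial datum"; the argument is the last paragraph of the proof
of Theorem 6.1, p. 12: "we inspect the decomposition of `u` constructed in Lemma 3.1 with
`f_k = −u_k u`. Using the decay of the kernel (3.8) and of the heat kernel, it is easy to check
that, under the assumption (6.2), all the terms in the decomposition `u = v + w + b` will again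
satisfy (6.2). It follows easily that `b` must vanish and therefore `u` is a mild solution").

* `KNSS2009_typeI_rate_mild_holds : KNSS2009_typeI_rate_mild` — **the discharge**. The printed
  argument is carried out in the tree along exactly the quoted lines: Lemma 3.1 in drift-mild
  form (`KNSS2009_weak_driftMild_holds`, `KNSSWeakDriftMildProofs.lean`: `u = U + b(t)` a.e.),
  the horizontal decay of the caloric and Duhamel terms which forces `b` to be constant
  (`KNSSMildDecayHorizontal.lean`, `KNSSMildDecayProofs.lean`: the window form at `ν = 1`,
  `KNSS2009_mild_of_rMulNorm_bounded_holds`), and the bookkeeping from the window form to the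
  hypotheses of Theorem 6.2 — general viscosity `ν > 0` by the time dilation
  `ũ(s, x) = ν⁻¹u(s/ν, x)`, the sub-slab bound `|x'|‖u‖ ≤ max C (R₀M)` on `(0, t] × ℝ³` from
  (6.4) and boundedness (`KNSS2009_typeI_rate_mild_of_mild_of_rMulNorm_bounded`,
  `KNSSTypeIRateMildBridge.lean`). This file composes the two.
* `KNSS2009_typeI_rate_mildBlowupSequence_of_liouville`,
  `KNSS2009_typeI_rate_rMulNorm_bounded_of_liouville`,
  `KNSS2009_regularity_typeI_rate_of_bound_C_over_r_of_liouville` — **consequences for the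
  decomposition of Theorem 6.2** (`KNSSTypeIRate`, `KNSSTypeIRateCore`, `KNSSTypeIRateMild`): with
  the mildness clause, the compactness ingredient over mild data (Lemma 6.1,
  `KNSS2009_typeI_rate_mildCompactness_holds`) and the vertex estimate over mild data
  (`KNSS2009_typeI_rate_mildVertex_holds`) now theorems, Steps 1–6 of the printed proof of
  Theorem 6.2 (arXiv pp. 12–13) are proved in the tree up to the single remaining named
  ingredient, the Liouville step `KNSS2009_typeI_rate_liouville` (Theorem 5.1 with Remark 6.1,
  applied to the blow-up limit; reduced to Theorem 5.1 in `KNSSTypeIRateLiouvilleMild.lean`):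
  `KNSS2009_typeI_rate_liouville → KNSS2009_typeI_rate_rMulNorm_bounded`, and Theorem 6.2 as
  vendored (`KNSS2009_regularity_typeI_rate`) from Theorem 6.1
  (`KNSS2009_regularity_bound_C_over_r`) and the Liouville step.

Nothing else is here: no statement is restated, and the Liouville step (Theorem 5.1, the deep
part of the paper) is not attempted.

## References

* G. Koch, N. Nadirashvili, G. Seregin, V. Šverák, *Liouville theorems for the Navier–Stokes
  equations and applications*, Acta Math. 203 (2009) 83–105 = arXiv:0709.3599 (arXiv pages):
  Theorem 6.2 (statement, mildness clause) and its proof, first sentence, p. 12, Steps 5–6,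
  p. 13; Theorem 6.1, proof, last paragraph, p. 12; Lemma 3.1, Remark 3.1, p. 7; §4 (i),
  Remark 4.1, (4.3)–(4.4), p. 8; Lemma 6.1, Remark 6.1, p. 11; Theorem 5.1, p. 9.
  [KochNadirashviliSereginSverak2009]
-/

noncomputable section

namespace Literature.Analysis.FluidPDE

/-! ### The mildness clause of Theorem 6.2, discharged -/

/-- **KNSS 2009, Theorem 6.2, the mildness clause — discharged** (Acta Math. 203 (2009) =
arXiv:0709.3599, Theorem 6.2, p. 12: "Moreover, `u` is a mild solution of the Navier–Stokes
equations (for a suitable initial datum)"; proof, first sentence: "We have seen in the proof of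
Theorem 6.1 that (6.4) implies that `u` is a mild solution"; proof of Theorem 6.1, last
paragraph, p. 12: Lemma 3.1 with `f_k = −u_k u`, the decay of the kernel (3.8) and of the heat
kernel, "`b` must vanish"). The named fact `KNSS2009_typeI_rate_mild` holds: a classical
solution of the unforced Navier–Stokes system with viscosity `ν > 0` on `ℝ³ × (0, T)`, bounded
on every `ℝ³ × (0, T')`, `T' < T`, with (6.4) `|x'|‖u(t, x)‖ ≤ C` for `|x'| ≥ R₀`, satisfies the
Oseen integral equation `u(t) = e^{ν(t−s)Δ}u(s) − B^ν_s(u, u)(t)` pointwise for all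
`0 < s < t < T`. Proof: the window form of the mildness clause of Theorem 6.1 at `ν = 1`
(`KNSS2009_mild_of_rMulNorm_bounded_holds`, `KNSSMildDecayProofs.lean`, itself assembled from
Lemma 3.1 in drift-mild form and the horizontal decay of the caloric and Duhamel terms), fed
into the proved reduction `KNSS2009_typeI_rate_mild_of_mild_of_rMulNorm_bounded`
(`KNSSTypeIRateMildBridge.lean`: viscosity normalisation by time dilation and the sub-slab
bound `|x'|‖u‖ ≤ max C (R₀M)`). [cite: KochNadirashviliSereginSverak2009, Thm 6.2 (mildness clause) and its proof, first sentence (arXiv p. 12), with the proof of Thm 6.1, last paragraph (p. 12)] -/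
theorem KNSS2009_typeI_rate_mild_holds : KNSS2009_typeI_rate_mild :=
  KNSS2009_typeI_rate_mild_of_mild_of_rMulNorm_bounded KNSS2009_mild_of_rMulNorm_bounded_holds

/-! ### The main step of Theorem 6.2 from the Liouville step alone -/

/-- **KNSS 2009, proof of Theorem 6.2, Steps 5–6 over mild data, from the Liouville step**
(arXiv:0709.3599 p. 13: compactness of the doubly rescaled mild solutions `w⁽ᵏ⁾` (Lemma 6.1),
the Liouville theorem for the ancient mild limit (Theorem 5.1 with Remark 6.1), and the
convergence at the vertex `w⁽ᵏ⁾(0, 0) → w(0, 0)`). With the compactness ingredient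
(`KNSS2009_typeI_rate_mildCompactness_holds`) and the vertex estimate
(`KNSS2009_typeI_rate_mildVertex_holds`) over mild data proved in the tree, the blow-up fact
`KNSS2009_typeI_rate_mildBlowupSequence` follows from the Liouville step
`KNSS2009_typeI_rate_liouville` alone (`KNSS2009_typeI_rate_mildBlowupSequence_of_mildCore`). [cite: KochNadirashviliSereginSverak2009, proof of Thm 6.2, last two paragraphs (arXiv p. 13)] -/
theorem KNSS2009_typeI_rate_mildBlowupSequence_of_liouville
    (h : KNSS2009_typeI_rate_liouville) : KNSS2009_typeI_rate_mildBlowupSequence :=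
  KNSS2009_typeI_rate_mildBlowupSequence_of_mildCore KNSS2009_typeI_rate_mildCompactness_holds h
    KNSS2009_typeI_rate_mildVertex_holds

/-- **KNSS 2009, Theorem 6.2, main step, from the Liouville step** (arXiv:0709.3599 pp. 12–13,
Steps 1–6 of the printed proof: under the hypotheses of Theorem 6.2, `f = |x'||u|` is bounded on
`ℝ³ × (0, T)`). Every ingredient of the three-layer decomposition (`KNSSTypeIRate`,
`KNSSTypeIRateCore`, `KNSSTypeIRateMild`) except the Liouville step is now a theorem — the
mildness clause (`KNSS2009_typeI_rate_mild_holds`), compactness and the vertex estimate over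
mild data — so `KNSS2009_typeI_rate_rMulNorm_bounded` rests on `KNSS2009_typeI_rate_liouville`
(Theorem 5.1 with Remark 6.1 for the blow-up limit) alone
(`KNSS2009_typeI_rate_rMulNorm_bounded_of_mildCore`). [cite: KochNadirashviliSereginSverak2009, Thm 6.2 and its proof (arXiv pp. 12–13)] -/
theorem KNSS2009_typeI_rate_rMulNorm_bounded_of_liouville (h : KNSS2009_typeI_rate_liouville) :
    KNSS2009_typeI_rate_rMulNorm_bounded :=
  KNSS2009_typeI_rate_rMulNorm_bounded_of_mildCore KNSS2009_typeI_rate_mild_holds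
    KNSS2009_typeI_rate_mildCompactness_holds h KNSS2009_typeI_rate_mildVertex_holds

/-- **KNSS 2009, Theorem 6.2 as vendored (`KNSS2009_regularity_typeI_rate`), from Theorem 6.1
and the Liouville step** (arXiv:0709.3599 p. 12: "By Theorem 6.1, it is enough to prove that
`f` is bounded in `ℝ³ × (0, T)`"; the boundedness of `f` is
`KNSS2009_typeI_rate_rMulNorm_bounded_of_liouville`). The remaining named inputs are Theorem 6.1
(`KNSS2009_regularity_bound_C_over_r`) and the Liouville step (`KNSS2009_typeI_rate_liouville`). [cite: KochNadirashviliSereginSverak2009, Thm 6.2 and its proof (arXiv pp. 12–13)] -/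
theorem KNSS2009_regularity_typeI_rate_of_bound_C_over_r_of_liouville
    (h61 : KNSS2009_regularity_bound_C_over_r) (h : KNSS2009_typeI_rate_liouville) :
    KNSS2009_regularity_typeI_rate :=
  KNSS2009_regularity_typeI_rate_of_parts h61 (KNSS2009_typeI_rate_rMulNorm_bounded_of_liouville h)

end Literature.Analysis.FluidPDE

end
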